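import Summits.BirchSwinnertonDyer.BirchSwinnertonDyer.Theorems.ByReductionTypeAtTwoRankOneNaiveSigmaEvalLog
import HarnessLib

/-!
# Sharp growth of the naive even sigma square at `2`: `‖[tⁿ](Σ/t²)‖₂ ≤ 2^{⌊3n/4⌋ − 1}`

Helpers for the route `ByReductionTypeAtTwo`, crux `RankOneAtTwoBigImageOddLocal`
(`--supports stmt-BirchSwinnertonDyer-23715`, cell bsd-f1-sign2, analytic lens; REF1 LEMMA 480 of the cell's
audit §480 made kernel).  For a Weierstrass equation over `ℚ₂` with `a₁ = 0`, integral `a₂, a₃, a₄, a₆`, the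
normalised even solution `Σ` of the sigma-square equation (`[t²]Σ = 1`, `[t³]Σ = 0`) and a logarithm `L` of
`S := Σ/t²` (`S·L′ = S′`, `L(0) = 0`), the coefficient bound `‖[t^k]L‖₂ ≤ 2^{v₂k + ⌊log₂(k−1)⌋ − 1}`
(`naiveSigmaLog_denominators_two`) and `v₂ k + ⌊log₂(k−1)⌋ ≤ ⌊3k/4⌋` (`k ≥ 3`, tight at `k = 4`) give, through
`S = exp L` and `v₂(m!) ≤ m − 1`:
* `norm_coeff_sigmaShift_sigmaShift_sharp`: `‖[tⁿ]S‖₂ · 2 ≤ 2^{⌊3n/4⌋}` for `n ≥ 1` (vs. `2ⁿ` in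
  `norm_coeff_sigmaShift_sigmaShift_le`);
* `summable_sigmaSq_of_norm_le_half`: `Σ(t) = Σ' [tⁿ]Σ·tⁿ` is a genuine sum on the CLOSED disc `‖t‖₂ ≤ ½` —
  the naive even sigma square converges on all of `E¹(ℚ₂)`.

## References
* [Mazur–Stein–Tate 2006, §4] (the sigma recursion); [Bernardi 1981, §1] (convergence of naive sigma functions).
-/

namespace Summit.BirchSwinnertonDyer.BirchSwinnertonDyer.Theorems.NaiveSigmaLogAtTwo

open PowerSeries Literature Literature.NumberTheory.EllipticCurves WeierstrassCurve
open scoped Classical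

/-! ## Exponent arithmetic -/

/-- `8a ≤ 3·2^a` for `a ≥ 3`. -/
theorem eight_mul_le_three_mul_two_pow {a : ℕ} (ha : 3 ≤ a) : 8 * a ≤ 3 * 2 ^ a := by
  induction a, ha using Nat.le_induction with
  | base => norm_num
  | succ n hn ih =>
    have h8 : 2 ^ 3 ≤ 2 ^ n := Nat.pow_le_pow_right two_pos hn
    rw [pow_succ]
    omega

/-- **`v₂ k + ⌊log₂(k − 1)⌋ ≤ ⌊3k/4⌋` for `k ≥ 3`** (tight at `k = 4`; `k ≤ 7` by cases, `k ≥ 8` from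
`v₂ k, log₂(k−1) ≤ log₂ k` and `8·log₂ k ≤ 3k`). [folklore] -/
theorem padicValNat_add_log_le_three_mul_div_four {k : ℕ} (hk : 3 ≤ k) :
    padicValNat 2 k + Nat.log 2 (k - 1) ≤ 3 * k / 4 := by
  by_cases hk8 : 8 ≤ k
  · have hk0 : k ≠ 0 := by omega
    have ha : 3 ≤ Nat.log 2 k := Nat.le_log_of_pow_le (by norm_num) hk8
    have hv : padicValNat 2 k ≤ Nat.log 2 k := padicValNat_le_nat_log k
    have hl : Nat.log 2 (k - 1) ≤ Nat.log 2 k := Nat.log_mono_right (Nat.sub_le k 1)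
    have hpow : 2 ^ Nat.log 2 k ≤ k := Nat.pow_log_le_self 2 hk0
    have h8 := eight_mul_le_three_mul_two_pow ha
    rw [Nat.le_div_iff_mul_le (by norm_num)]
    omega
  · interval_cases k
    · rw [padicValNat.eq_zero_of_not_dvd (by norm_num)]; norm_num
    · have := padicValNat_le_nat_log (p := 2) 4; norm_num at this ⊢; omega
    · rw [padicValNat.eq_zero_of_not_dvd (by norm_num)]; norm_num
    · have := padicValNat_le_nat_log (p := 2) 6; norm_num at this ⊢; omega
    · rw [padicValNat.eq_zero_of_not_dvd (by norm_num)]; norm_num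

/-! ## Coefficient bounds for `exp L` under `‖[t^k]L‖·2 ≤ 2^{⌊3k/4⌋}` -/

/-- `‖[tⁿ](L^m)‖ ≤ 2^{⌊3n/4⌋}/2^m` when `‖[t^k]L‖·2 ≤ 2^{⌊3k/4⌋}` for all `k` (ultrametric Cauchy product;
`⌊3i/4⌋ + ⌊3j/4⌋ ≤ ⌊3(i+j)/4⌋`). -/
theorem norm_coeff_pow_le_sharp {L : ℚ_[2]⟦X⟧} (hLb : ∀ k : ℕ, ‖coeff k L‖ * 2 ≤ 2 ^ (3 * k / 4)) :
    ∀ m n : ℕ, ‖coeff n (L ^ m)‖ ≤ 2 ^ (3 * n / 4) / 2 ^ m := by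
  intro m
  induction m with
  | zero =>
    intro n
    rw [pow_zero, pow_zero, div_one, coeff_one]
    split_ifs with h
    · rw [norm_one]; exact one_le_pow₀ (by norm_num)
    · rw [norm_zero]; positivity
  | succ m ih =>
    intro n
    rw [pow_succ, PowerSeries.coeff_mul]
    refine IsUltrametricDist.norm_sum_le_of_forall_le_of_nonneg (by positivity) fun ij hij => ?_
    have hn : ij.1 + ij.2 = n := Finset.HasAntidiagonal.mem_antidiagonal.mp hij
    have hj : ‖coeff ij.2 L‖ ≤ 2 ^ (3 * ij.2 / 4) / 2 := by
      rw [le_div_iff₀ (by norm_num : (0 : ℝ) < 2)]; exact hLb ij.2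
    have hexp : 3 * ij.1 / 4 + 3 * ij.2 / 4 ≤ 3 * n / 4 := by
      rw [← hn, mul_add]; exact Nat.add_div_le_add_div _ _ _
    rw [norm_mul]
    calc ‖coeff ij.1 (L ^ m)‖ * ‖coeff ij.2 L‖ ≤ (2 ^ (3 * ij.1 / 4) / 2 ^ m) * (2 ^ (3 * ij.2 / 4) / 2) :=
          mul_le_mul (ih ij.1) hj (norm_nonneg _) (by positivity)
      _ = 2 ^ (3 * ij.1 / 4 + 3 * ij.2 / 4) / 2 ^ (m + 1) := by rw [pow_add, pow_succ]; ring
      _ ≤ 2 ^ (3 * n / 4) / 2 ^ (m + 1) := by gcongr; norm_num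

/-- `‖[tⁿ] exp(L)‖·2 ≤ 2^{⌊3n/4⌋}` for `n ≥ 1` when `L(0) = 0` and `‖[t^k]L‖·2 ≤ 2^{⌊3k/4⌋}`
(`‖1/m!‖₂ = 2^{v₂(m!)} ≤ 2^{m−1}` for `m ≥ 1`; the `m = 0` term vanishes for `n ≥ 1`). -/
theorem norm_coeff_exp_subst_sharp {L : ℚ_[2]⟦X⟧} (hL0 : constantCoeff L = 0)
    (hLb : ∀ k : ℕ, ‖coeff k L‖ * 2 ≤ 2 ^ (3 * k / 4)) {n : ℕ} (hn : 1 ≤ n) :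
    ‖coeff n ((exp ℚ_[2]).subst L)‖ * 2 ≤ 2 ^ (3 * n / 4) := by
  rw [← le_div_iff₀ (by norm_num : (0 : ℝ) < 2), coeff_subst_eq_sum_range_of_constantCoeff _ hL0]
  refine IsUltrametricDist.norm_sum_le_of_forall_le_of_nonneg (by positivity) fun m _ => ?_
  rw [norm_mul, coeff_exp]
  rcases Nat.eq_zero_or_pos m with rfl | hm
  · -- the `m = 0` term: `coeff n (L^0) = [n = 0] = 0`
    rw [pow_zero, coeff_one, if_neg (by omega), norm_zero, mul_zero]; positivity
  have hf0 : ((m.factorial : ℕ) : ℚ_[2]) ≠ 0 := by exact_mod_cast m.factorial_ne_zero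
  have hfact : ‖algebraMap ℚ ℚ_[2] (1 / (m.factorial : ℚ))‖ ≤ 2 ^ (m - 1) := by
    rw [map_div₀, map_one, map_natCast, one_div, norm_inv, Padic.norm_eq_zpow_neg_valuation hf0,
      Padic.valuation_natCast, zpow_neg, inv_inv, zpow_natCast]
    exact_mod_cast pow_le_pow_right₀ (by norm_num : (1 : ℝ) ≤ 2)
      (Nat.le_sub_one_of_lt (padicValNat_factorial_lt_of_ne_zero 2 hm.ne'))
  calc ‖algebraMap ℚ ℚ_[2] (1 / (m.factorial : ℚ))‖ * ‖coeff n (L ^ m)‖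
        ≤ 2 ^ (m - 1) * (2 ^ (3 * n / 4) / 2 ^ m) :=
        mul_le_mul hfact (norm_coeff_pow_le_sharp hLb m n) (norm_nonneg _) (by positivity)
    _ = 2 ^ (3 * n / 4) / 2 * (2 ^ (m - 1) * 2 / 2 ^ m) := by ring
    _ = 2 ^ (3 * n / 4) / 2 := by rw [← pow_succ, Nat.sub_add_cancel hm, div_self (by positivity), mul_one]

/-! ## The sharp growth of `Σ/t²` and convergence on the closed disc `‖t‖ ≤ ½` -/

/-- **REF1 LEMMA 480 (kernel)**: `‖[tⁿ](Σ/t²)‖₂ · 2 ≤ 2^{⌊3n/4⌋}` for `n ≥ 1` — for `a₁ = 0`, integral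
`a₂, a₃, a₄, a₆`, `Σ` the normalised even solution of the sigma-square equation and `L` a logarithm of
`Σ/t²`.  Sharpens `norm_coeff_sigmaShift_sigmaShift_le` (`≤ 2ⁿ`); tight at `n = 4` in general.
[cite: MazurSteinTate2006, §4] [cite: Bernardi1981, §1] -/
theorem norm_coeff_sigmaShift_sigmaShift_sharp (W : WeierstrassCurve ℚ_[2]) (Sq L : ℚ_[2]⟦X⟧) (ha1 : W.a₁ = 0)
    (ha2 : ‖W.a₂‖ ≤ 1) (ha3 : ‖W.a₃‖ ≤ 1) (ha4 : ‖W.a₄‖ ≤ 1) (ha6 : ‖W.a₆‖ ≤ 1)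
    (h2 : coeff 2 Sq = 1) (h3 : coeff 3 Sq = 0) (hODE : W.SatisfiesSigmaSqODE Sq 0) (hL0 : constantCoeff L = 0)
    (hL : sigmaShift (sigmaShift Sq) * d⁄dX ℚ_[2] L = d⁄dX ℚ_[2] (sigmaShift (sigmaShift Sq))) {n : ℕ}
    (hn : 1 ≤ n) : ‖coeff n (sigmaShift (sigmaShift Sq))‖ * 2 ≤ 2 ^ (3 * n / 4) := by
  have hS0 : constantCoeff (sigmaShift (sigmaShift Sq)) = 1 := by
    rw [constantCoeff_sigmaShift, coeff_sigmaShift, h2]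
  obtain ⟨hl1, hl2, -, -, hbound⟩ := naiveSigmaLog_denominators_two W Sq L ha1 ha2 ha3 ha4 ha6 h2 h3 hODE hL
  have hLb : ∀ k : ℕ, ‖coeff k L‖ * 2 ≤ 2 ^ (3 * k / 4) := by
    intro k
    rcases Nat.lt_or_ge k 3 with hk | hk
    · interval_cases k
      · rw [coeff_zero_eq_constantCoeff, hL0, norm_zero, zero_mul]; positivity
      · rw [hl1, norm_zero, zero_mul]; positivity
      · rw [hl2]; norm_num; linarith
    · exact (hbound k hk).trans
        (pow_le_pow_right₀ (by norm_num) (padicValNat_add_log_le_three_mul_div_four hk))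
  rw [eq_exp_subst_of_mul_derivative hL0 hS0 hL]
  exact norm_coeff_exp_subst_sharp hL0 hLb hn

/-- **The naive even sigma square converges on the closed disc `‖t‖₂ ≤ ½`** (all of `E¹(ℚ₂)`): under
the hypotheses above, `n ↦ [tⁿ]Σ·tⁿ` is summable whenever `‖t‖ ≤ ½` (the tail from `n = 2` is
`[tⁿ](Σ/t²)·tⁿ⁺²` with `‖·‖ ≤ 2^{⌊3n/4⌋−1}·2^{−n−2} ≤ (2^{-1/4})ⁿ`), so `padicEval Σ t` is a genuine sum
there — in particular at level one, `‖t‖ = ½`, outside the disc `‖t‖ ≤ ¼` of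
`norm_coeff_sigmaShift_sigmaShift_le`. [cite: Bernardi1981, §1] -/
theorem summable_sigmaSq_of_norm_le_half (W : WeierstrassCurve ℚ_[2]) (Sq L : ℚ_[2]⟦X⟧) (ha1 : W.a₁ = 0)
    (ha2 : ‖W.a₂‖ ≤ 1) (ha3 : ‖W.a₃‖ ≤ 1) (ha4 : ‖W.a₄‖ ≤ 1) (ha6 : ‖W.a₆‖ ≤ 1)
    (h2 : coeff 2 Sq = 1) (h3 : coeff 3 Sq = 0) (hODE : W.SatisfiesSigmaSqODE Sq 0) (hL0 : constantCoeff L = 0)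
    (hL : sigmaShift (sigmaShift Sq) * d⁄dX ℚ_[2] L = d⁄dX ℚ_[2] (sigmaShift (sigmaShift Sq)))
    {t : ℚ_[2]} (ht : ‖t‖ ≤ 2⁻¹) : Summable fun n : ℕ => coeff n Sq * t ^ n := by
  -- shift by two: `[tⁿ⁺²]Σ = [tⁿ](Σ/t²)`
  rw [← summable_nat_add_iff 2]
  have hcoef : ∀ n, coeff (n + 2) Sq = coeff n (sigmaShift (sigmaShift Sq)) := fun n => by
    rw [coeff_sigmaShift, coeff_sigmaShift]
  -- comparison with the real geometric series `(2^{-1/4})ⁿ`, via `2^{⌊3n/4⌋} ≤ (2^{3/4})ⁿ`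
  set r : ℝ := (2 : ℝ) ^ (-(1 / 4 : ℝ)) with hr
  have hr0 : 0 ≤ r := by positivity
  have hr1 : r < 1 := Real.rpow_lt_one_of_one_lt_of_neg (by norm_num) (by norm_num)
  refine Summable.of_norm_bounded (g := fun n : ℕ => r ^ n) (summable_geometric_of_lt_one hr0 hr1) fun n => ?_
  rw [hcoef, norm_mul, norm_pow]
  have ht0 : 0 ≤ ‖t‖ := norm_nonneg t
  have htn : ‖t‖ ^ (n + 2) ≤ (2⁻¹ : ℝ) ^ (n + 2) := pow_le_pow_left₀ ht0 ht _
  -- the coefficient bound (trivial at `n = 0`: `[t⁰](Σ/t²) = 1`)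
  have hc : ‖coeff n (sigmaShift (sigmaShift Sq))‖ ≤ (2 : ℝ) ^ ((3 / 4 : ℝ) * n) := by
    rcases Nat.eq_zero_or_pos n with rfl | hn
    · rw [coeff_zero_eq_constantCoeff, constantCoeff_sigmaShift, coeff_sigmaShift, h2, norm_one]
      norm_num
    · have h := norm_coeff_sigmaShift_sigmaShift_sharp W Sq L ha1 ha2 ha3 ha4 ha6 h2 h3 hODE hL0 hL hn
      have hfloor : ((2 : ℝ) ^ (3 * n / 4) : ℝ) ≤ (2 : ℝ) ^ ((3 / 4 : ℝ) * n) := by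
        rw [← Real.rpow_natCast]
        refine Real.rpow_le_rpow_of_exponent_le (by norm_num) ?_
        rw [div_mul_eq_mul_div, le_div_iff₀ (by norm_num : (0:ℝ) < 4)]
        exact_mod_cast Nat.div_mul_le_self (3 * n) 4
      linarith [norm_nonneg (coeff n (sigmaShift (sigmaShift Sq)))]
  calc ‖coeff n (sigmaShift (sigmaShift Sq))‖ * ‖t‖ ^ (n + 2)
      ≤ (2 : ℝ) ^ ((3 / 4 : ℝ) * n) * (2⁻¹ : ℝ) ^ (n + 2) :=
        mul_le_mul hc htn (by positivity) (by positivity)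
    _ ≤ (2 : ℝ) ^ ((3 / 4 : ℝ) * n) * (2⁻¹ : ℝ) ^ n :=
        mul_le_mul_of_nonneg_left (pow_le_pow_of_le_one (by norm_num) (by norm_num) (by omega))
          (by positivity)
    _ = r ^ n := by
        rw [hr, ← Real.rpow_natCast ((2:ℝ) ^ (-(1/4:ℝ))), ← Real.rpow_mul (by norm_num),
          show (2⁻¹ : ℝ) = (2 : ℝ) ^ (-(1 : ℝ)) by rw [Real.rpow_neg_one], ← Real.rpow_natCast,
          ← Real.rpow_mul (by norm_num), ← Real.rpow_add (by norm_num)]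
        congr 1; ring

end Summit.BirchSwinnertonDyer.BirchSwinnertonDyer.Theorems.NaiveSigmaLogAtTwo
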